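import Summits.BirchSwinnertonDyer.BirchSwinnertonDyer.Theorems.SchneiderFreeAdditiveX3GordCellSliverSupportSeven
import Literature.NumberTheory.EllipticCurves.InertiaInvariantsMultiplicativeProofs
import HarnessLib

/-!
# Route `SchneiderFreeAdditiveX3` (K1 door), crux r3 `GordTwoBranchIMC` (item 19177): the reducible (G-ord, `e = 2`) row is EMPTY at
# `p ∈ {11, 17, 19, 43, 67, 163}` — the crux has content only at `p ∈ {3, 5, 7, 13, 37}` (Mazur's table displayed), and BY NAME it reduces to
# its five instances there

Cell `bsd-schneider-ideate`, seat `bsd-schneider-door-c5` (prover, generation 35; assembly layer; `--supports` 19177).  PARTITION: board row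
B6 ∩ X3 ∩ sst-twist, `r = 1`, (G-ord, `e = 2`) half (2 560 of 7 101 census pairs: 2 411 at `p = 3`, 131 at `5`, 16 at `7`, 2 at `13`, none
else) of `Rank1Residual.partition` — ASSEMBLY; types-the-object-of nothing new; closes none of B6's cells (BSD NOT advanced).  bears_on: K1-door
(items 18971/18972 → 19177 r3 `GordTwoBranchIMC`).

WHY.  The crux quantifies over every odd prime `p`, but its hypotheses `ClassX3 W p` (`Red`: a rational `p`-isogeny; `Addv`) and
`SubGordTwo W p` (census semistability index `e = 12 / gcd(12, v_p(Δ_min)) = 2`, i.e. `v_p(Δ_min) ≡ 6 (mod 12)`) are jointly satisfiable only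
at few primes.  By Mazur's theorem (`mazur_isogeny_irreducible`) `p ∈ {2, 3, 5, 7, 11, 13, 17, 19, 37, 43, 67, 163}`; by Mazur's `j`-table
(`mazur_j_mem_of_not_hasIrreducibleModPGaloisRep_of_eleven_le`) the `j`-invariant at `p ∈ {11, 17, 19, 37, 43, 67, 163}` is one of eleven
values, and this generation's `JInvariantObstruction` kills `19, 43, 67, 163` (`j_p − 1728 = −p·□` ⟹ `v_p(Δ_min)` odd).  THIS FILE adds the
second elementary obstruction — **`3 ∤ v_p(j)` ⟹ `3 ∤ v_p(Δ_min)` ⟹ `e ∈ {3, 6, 12}`** (from `j·Δ_min = c₄(W_ℤ)³`) — which kills the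
non-CM moduli of `X₀(11)` (`j = −11²`, `−11·131³`) and `X₀(17)` (`j = −17²·101³/2`, `−17·373³/2¹⁷`), the CM modulus `j = −2¹⁵` of `X₀(11)`
falling to the first obstruction (`j − 1728 = −2⁶·7²·11`).  Outcome:
* §1 `not_three_dvd_padicValInt_minimalDiscriminantInt_of_j_eq_div` and `semistabilityIndex_ne_two_of_j_eq_div` (UNCONDITIONAL), with the
  five instances at `11` and `17`;
* §2 `not_subGordTwo_of_red_eleven` / `…_seventeen` and **`false_of_classX3_of_subGordTwo_of_mem`**: the reducible (G-ord, `e = 2`) row is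
  EMPTY at `p ∈ {11, 17, 19, 43, 67, 163}` (Mazur's `j`-table displayed);
* §3 **`mem_rowPrimes_of_classX3_of_subGordTwo`**: on the row, `p ∈ {2, 3, 5, 7, 13, 37}` (Mazur's Thm. 1 and `j`-table displayed) — the
  census primes `{3, 5, 7, 13}` plus `37` (where only the two `X₀(37)` moduli can give row data, beyond the census bound and with `5·7 ∣ N`);
* §4 **`gordTwoBranchIMC_of_rowPrimes`**: the crux BY NAME from its OWN instances at `p ∈ {3, 5, 7, 13, 37}` (VACUOUS elsewhere).  Read with
  generation 35's `KYBranchSliverSupportSeven.gordTwoBranchIMC_of_anacong_of_seven` (same hypotheses, not restated here): the PUB/PRE sentences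
  of the record are CONSUMED only at `p ∈ {3, 5, 13, 37}` and the sliver only at `p = 7`.

HONEST FRAMING: §1 is unconditional; §2–§4 are CONDITIONAL on the displayed published facts (Mazur 1978); no definition, no new named fact, no
`sorry`; the crux 19177 stays OPEN; BSD is proved for no curve; «closes rung: none».
References: Mazur, Invent. Math. 44 (1978) Thm. 1, Thm. 7.1, table p. 129 [Mazur1978]; Lozano-Robledo, Math. Ann. 357 (2013) Table 4
[LozanoRobledo2013MathAnn]; Silverman AEC III.1, VII.1.3(b) [SilvermanAEC2009]; this seat p737457 (F24a), p738212 (F24c), p734398 (F21).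
-/

set_option autoImplicit false
-- `Summit.<P>.<Sub>` repeats `BirchSwinnertonDyer` by the tree's layout convention (D-0017)
set_option linter.dupNamespace false

noncomputable section

open scoped Classical NumberField

open Field NumberField IsDedekindDomain WeierstrassCurve PowerSeries
  Literature.NumberTheory.EllipticCurves Literature.NumberTheory.EllipticCurves.GreenbergSelmer
  Literature.NumberTheory.GaloisRepresentations Literature.NumberTheory.GaloisCohomology
  Literature.NumberTheory.EllipticCurves.ModularForms Literature.NumberTheory.EllipticCurves.Rank1Residual
  Literature.NumberTheory.EllipticCurves.Rank1Residual.Typed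
  Literature.NumberTheory.EllipticCurves.KellerYin2024 Literature.NumberTheory.EllipticCurves.CaiShuTian2014
  Literature.NumberTheory.IwasawaTheory Literature.NumberTheory.IwasawaTheory.Greenberg2016
  Literature.NumberTheory.IwasawaTheory.Greenberg2006
  Literature.NumberTheory.EllipticCurves.Rubin1991 Literature.NumberTheory.EllipticCurves.DeShalit1987
  Literature.NumberTheory.EllipticCurves.Hida2010MuInvariant Literature.NumberTheory.EllipticCurves.BCGKPST2020
  Summit.BirchSwinnertonDyer.Rank1Residual Summit.BirchSwinnertonDyer.Rank1Residual.X11b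
  Summit.BirchSwinnertonDyer.Rank1Residual.X11b.AcSelmer Summit.BirchSwinnertonDyer.Rank1Residual.X11b.Halves
  Summit.BirchSwinnertonDyer.Rank1Residual.Additive Summit.BirchSwinnertonDyer.Rank1Residual.GaloisImage
  Summit.BirchSwinnertonDyer.BirchSwinnertonDyer.Theorems
  Summit.BirchSwinnertonDyer.BirchSwinnertonDyer.Theorems.EisensteinPrimesMuLambda
  Summit.BirchSwinnertonDyer.BirchSwinnertonDyer.Theorems.SchneiderFree
  Summit.BirchSwinnertonDyer.BirchSwinnertonDyer.Theorems.SchneiderFree.KYRead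
  Summit.BirchSwinnertonDyer.BirchSwinnertonDyer.Theses.SchneiderFreeAdditiveX3
  Summit.BirchSwinnertonDyer.BirchSwinnertonDyer.Theorems.SchneiderFreeAdditiveX3
  Summit.BirchSwinnertonDyer.BirchSwinnertonDyer.Theorems.SchneiderFreeAdditiveX3.ControlDischarged
  Summit.BirchSwinnertonDyer.BirchSwinnertonDyer.Theorems.SchneiderFreeAdditiveX3.KYBranchThreeAnomalousClassCurrency
  Summit.BirchSwinnertonDyer.BirchSwinnertonDyer.Theorems.SchneiderFreeAdditiveX3.KYBranchFiveLeDoor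
open Literature.NumberTheory.EllipticCurves.CastellaGrossiLeeSkinner2022
  (prop14_residualCharacterSelmer_finite thm212_exists_isKatzLFunction prop125_characterGrSelmerDual_torsion_muZero_dim
    cor126_residualCharacter_globalLift cor126_residualCharacter_localSurjective)
open Literature.NumberTheory.EllipticCurves.KellerYin2024 (thm122_rubinHida_residualPair_unrSelmer prop125_residualPair_unrSelmer_imprimitive
  thm351_anacong_branch_three_allTwists thm351_anacong_charLambda_branch_five_le)

namespace Summit.BirchSwinnertonDyer.BirchSwinnertonDyer.Theorems.SchneiderFreeAdditiveX3.KYBranchRowPrimes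

/-! ### §1 The second obstruction: `3 ∤ v_p(j)` ⟹ `3 ∤ v_p(Δ_min)` ⟹ `e ≠ 2` — UNCONDITIONAL -/

/-- **`j·Δ_min = c₄(W_ℤ)³` in `ℤ`-currency with `j = a/b`**: `a·Δ_min = b·c₄(W_ℤ)³` for a globally minimal elliptic `W/ℚ` with `j(W) = a/b`.
[cite: SilvermanAEC2009, III.1 (`j = c₄³/Δ`) and VIII.8 (minimal discriminant)] -/
theorem int_j_mul_minimalDiscriminantInt_eq (W : WeierstrassCurve ℚ) [W.IsElliptic] [W.IsGloballyMinimal] {a b : ℤ} (hb : b ≠ 0)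
    (hj : W.j = (a : ℚ) / (b : ℚ)) : a * minimalDiscriminantInt W = b * (integralModelInt W).c₄ ^ 3 := by
  have h := W.j_mul_Δ_eq_c₄_pow
  rw [hj, ← cast_minimalDiscriminantInt, ← cast_integralModelInt_c₄] at h
  have hb' : (b : ℚ) ≠ 0 := by exact_mod_cast hb
  have h' : (a : ℚ) * (minimalDiscriminantInt W : ℚ) = (b : ℚ) * (((integralModelInt W).c₄ : ℤ) : ℚ) ^ 3 := by
    rw [← h]; field_simp
  exact_mod_cast h'

/-- **The second `j`-invariant obstruction.**  Let `W/ℚ` be a globally minimal elliptic curve with `j(W) = a/b`, `a ≠ 0`, `p ∤ b`.  If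
`3 ∤ v_p(a)` then `3 ∤ v_p(Δ_min(W))`: from `a·Δ_min = b·c₄³`, `v_p(a) + v_p(Δ_min) = 3·v_p(c₄)`.  UNCONDITIONAL.
[cite: SilvermanAEC2009, III.1 and VII.1 Prop. 1.3(b)] -/
theorem not_three_dvd_padicValInt_minimalDiscriminantInt_of_j_eq_div {p : ℕ} [hp : Fact p.Prime] (W : WeierstrassCurve ℚ) [W.IsElliptic]
    [W.IsGloballyMinimal] {a b : ℤ} (ha : a ≠ 0) (hb : b ≠ 0) (hpb : ¬ (p : ℤ) ∣ b) (hj : W.j = (a : ℚ) / (b : ℚ))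
    (h3 : ¬ 3 ∣ padicValInt p a) : ¬ 3 ∣ padicValInt p (minimalDiscriminantInt W) := by
  have hD : minimalDiscriminantInt W ≠ 0 := minimalDiscriminantInt_ne_zero W
  have key := int_j_mul_minimalDiscriminantInt_eq W hb hj
  have hc0 : (integralModelInt W).c₄ ≠ 0 := by
    intro h0
    rw [h0, zero_pow three_ne_zero, mul_zero] at key
    exact mul_ne_zero ha hD key
  have hv := congrArg (padicValInt p) key
  rw [padicValInt.mul ha hD, padicValInt.mul hb (pow_ne_zero 3 hc0), padicValInt.eq_zero_of_not_dvd hpb, pow_succ, pow_two,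
    padicValInt.mul (mul_ne_zero hc0 hc0) hc0, padicValInt.mul hc0 hc0] at hv
  omega

/-- `12 / gcd(12, v) ≠ 2` when `3 ∤ v` (the quotient is `3`, `6` or `12`). [folklore] -/
theorem twelve_div_gcd_ne_two_of_not_three_dvd {v : ℕ} (hv : ¬ 3 ∣ v) : 12 / Nat.gcd 12 v ≠ 2 := by
  set g := Nat.gcd 12 v with hg
  have hg12 : g ∣ 12 := Nat.gcd_dvd_left 12 v
  have hgv : g ∣ v := Nat.gcd_dvd_right 12 v
  have hg3 : ¬ 3 ∣ g := fun h3 => hv (h3.trans hgv)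
  have hgle : g ≤ 12 := Nat.le_of_dvd (by norm_num) hg12
  interval_cases g <;> omega

/-- **Under the hypotheses of the second obstruction the census semistability index at `p` is not `2`** (`e = 12 / gcd(12, v_p(Δ_min))` with
`3 ∤ v_p(Δ_min)` lies in `{3, 6, 12}`). UNCONDITIONAL. [cite: SilvermanAEC2009, VII.1 Prop. 1.3(b)] -/
theorem semistabilityIndex_ne_two_of_j_eq_div {p : ℕ} [Fact p.Prime] (W : WeierstrassCurve ℚ) [W.IsElliptic] [W.IsGloballyMinimal]
    {a b : ℤ} (ha : a ≠ 0) (hb : b ≠ 0) (hpb : ¬ (p : ℤ) ∣ b) (hj : W.j = (a : ℚ) / (b : ℚ)) (h3 : ¬ 3 ∣ padicValInt p a) :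
    Additive.semistabilityIndex W p ≠ 2 := by
  unfold Additive.semistabilityIndex
  exact twelve_div_gcd_ne_two_of_not_three_dvd (not_three_dvd_padicValInt_minimalDiscriminantInt_of_j_eq_div W ha hb hpb hj h3)

/-- `v₁₁(−11²) = 2`. [folklore] -/
theorem padicValInt_eleven_neg_sq : padicValInt 11 (-121) = 2 := by
  have h : (-121 : ℤ) = -((11 : ℕ) : ℤ) ^ 2 := by norm_num
  rw [h, padicValInt, Int.natAbs_neg, Int.natAbs_pow, Int.natAbs_natCast, padicValNat.prime_pow]

/-- `v₁₁(−11·131³) = 1`. [folklore] -/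
theorem padicValInt_eleven_X0_eleven_nonCM : padicValInt 11 (-24729001) = 1 := by
  haveI : Fact (Nat.Prime 11) := ⟨by norm_num⟩
  have h : (-24729001 : ℤ) = (-2248091 : ℤ) * (11 : ℕ) := by norm_num
  rw [h, padicValInt_mul_eq_succ _ (by norm_num), padicValInt.eq_zero_of_not_dvd (by omega)]

/-- `v₁₇(−17²·101³) = 2`. [folklore] -/
theorem padicValInt_seventeen_X0_seventeen_a : padicValInt 17 (-297756989) = 2 := by
  haveI : Fact (Nat.Prime 17) := ⟨by norm_num⟩
  have h : (-297756989 : ℤ) = (-1030301 : ℤ) * (17 : ℕ) * (17 : ℕ) := by norm_num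
  rw [h, padicValInt_mul_eq_succ _ (by norm_num), padicValInt_mul_eq_succ _ (by norm_num), padicValInt.eq_zero_of_not_dvd (by omega)]

/-- `v₁₇(−17·373³) = 1`. [folklore] -/
theorem padicValInt_seventeen_X0_seventeen_b : padicValInt 17 (-882216989) = 1 := by
  haveI : Fact (Nat.Prime 17) := ⟨by norm_num⟩
  have h : (-882216989 : ℤ) = (-51895117 : ℤ) * (17 : ℕ) := by norm_num
  rw [h, padicValInt_mul_eq_succ _ (by norm_num), padicValInt.eq_zero_of_not_dvd (by omega)]

/-- **The three `X₀(11)` moduli are off `e = 2` at `11`**: `j = −2¹⁵` (`j − 1728 = −2⁶·7²·11`, first obstruction), `j = −11²` and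
`j = −11·131³` (`v₁₁(j) = 2, 1`, second obstruction). UNCONDITIONAL. [cite: LozanoRobledo2013MathAnn, Table 4] [cite: SilvermanAEC2009, VII.1 Prop. 1.3(b)] -/
theorem semistabilityIndex_ne_two_eleven_of_j_eq (W : WeierstrassCurve ℚ) [W.IsElliptic] [W.IsGloballyMinimal] [Fact (Nat.Prime 11)]
    (hj : W.j = -32768 ∨ W.j = -121 ∨ W.j = -24729001) : Additive.semistabilityIndex W 11 ≠ 2 := by
  rcases hj with hj | hj | hj
  · have hj' : W.j = ((-32768 : ℤ) : ℚ) := by rw [hj]; norm_num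
    have hfac : (-32768 : ℤ) - 1728 = (11 : ℕ) * (-3136 : ℤ) := by norm_num
    exact JInvariantObstruction.semistabilityIndex_ne_two_of_j_eq W hj' hfac (by omega)
  · exact semistabilityIndex_ne_two_of_j_eq_div W (a := -121) (b := 1) (by norm_num) one_ne_zero (by omega) (by rw [hj]; norm_num)
      (by rw [padicValInt_eleven_neg_sq]; omega)
  · exact semistabilityIndex_ne_two_of_j_eq_div W (a := -24729001) (b := 1) (by norm_num) one_ne_zero (by omega) (by rw [hj]; norm_num)
      (by rw [padicValInt_eleven_X0_eleven_nonCM]; omega)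

/-- **The two `X₀(17)` moduli are off `e = 2` at `17`**: `j = −17²·101³/2`, `−17·373³/2¹⁷` (`v₁₇(j) = 2, 1`). UNCONDITIONAL.
[cite: LozanoRobledo2013MathAnn, Table 4] [cite: SilvermanAEC2009, VII.1 Prop. 1.3(b)] -/
theorem semistabilityIndex_ne_two_seventeen_of_j_eq (W : WeierstrassCurve ℚ) [W.IsElliptic] [W.IsGloballyMinimal] [Fact (Nat.Prime 17)]
    (hj : W.j = -297756989 / 2 ∨ W.j = -882216989 / 131072) : Additive.semistabilityIndex W 17 ≠ 2 := by
  rcases hj with hj | hj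
  · exact semistabilityIndex_ne_two_of_j_eq_div W (a := -297756989) (b := 2) (by norm_num) two_ne_zero (by omega) (by rw [hj]; norm_num)
      (by rw [padicValInt_seventeen_X0_seventeen_a]; omega)
  · exact semistabilityIndex_ne_two_of_j_eq_div W (a := -882216989) (b := 131072) (by norm_num) (by norm_num) (by omega)
      (by rw [hj]; norm_num) (by rw [padicValInt_seventeen_X0_seventeen_b]; omega)

/-! ### §2 The reducible (G-ord, `e = 2`) row is EMPTY at `p ∈ {11, 17, 19, 43, 67, 163}` -/

/-- **At `p ∈ {11, 17, 19, 43, 67, 163}` no curve carries both a rational `p`-isogeny and the census index `e = 2` at `p`** (Mazur's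
`j`-table `mazur_j_mem_of_not_hasIrreducibleModPGaloisRep_of_eleven_le` displayed; the eleven moduli fall to the two obstructions — generation
35's `JInvariantObstruction` at `19, 43, 67, 163` and the CM point of `X₀(11)`, §1 at the non-CM points of `X₀(11)`, `X₀(17)`).  CONDITIONAL on
the displayed published fact. [cite: Mazur1978, Thm. 1 and table p. 129] [cite: LozanoRobledo2013MathAnn, Table 4] -/
theorem semistabilityIndex_ne_two_of_red_of_mem_six (hJ : mazur_j_mem_of_not_hasIrreducibleModPGaloisRep_of_eleven_le) {p : ℕ} [Fact p.Prime]
    (hp : p = 11 ∨ p = 17 ∨ p = 19 ∨ p = 43 ∨ p = 67 ∨ p = 163) (W : WeierstrassCurve ℚ) [W.IsElliptic] [W.IsGloballyMinimal]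
    (hred : ¬ W.HasIrreducibleModPGaloisRep p) : Additive.semistabilityIndex W p ≠ 2 := by
  obtain ⟨rfl, hj⟩ | ⟨rfl, hj⟩ | ⟨rfl, -⟩ | ⟨rfl, -⟩ | ⟨rfl, -⟩ | ⟨rfl, -⟩ | ⟨rfl, -⟩ := hJ W p (by omega) (by omega) hred
  · exact semistabilityIndex_ne_two_eleven_of_j_eq W hj
  · exact semistabilityIndex_ne_two_seventeen_of_j_eq W hj
  · exact KYBranchSliverSupportSeven.semistabilityIndex_ne_two_of_red_of_mem hJ (Or.inl rfl) W hred
  · omega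
  · exact KYBranchSliverSupportSeven.semistabilityIndex_ne_two_of_red_of_mem hJ (Or.inr (Or.inl rfl)) W hred
  · exact KYBranchSliverSupportSeven.semistabilityIndex_ne_two_of_red_of_mem hJ (Or.inr (Or.inr (Or.inl rfl))) W hred
  · exact KYBranchSliverSupportSeven.semistabilityIndex_ne_two_of_red_of_mem hJ (Or.inr (Or.inr (Or.inr rfl))) W hred

/-- **The reducible (G-ord, `e = 2`) row is EMPTY at `p ∈ {11, 17, 19, 43, 67, 163}`**: `ClassX3 W p ∧ SubGordTwo W p` is contradictory there.
CONDITIONAL on Mazur's `j`-table (displayed). [cite: Mazur1978, Thm. 1 and table p. 129] -/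
theorem false_of_classX3_of_subGordTwo_of_mem (hJ : mazur_j_mem_of_not_hasIrreducibleModPGaloisRep_of_eleven_le) {p : ℕ} [Fact p.Prime]
    (hp : p = 11 ∨ p = 17 ∨ p = 19 ∨ p = 43 ∨ p = 67 ∨ p = 163) (W : WeierstrassCurve ℚ) [W.IsElliptic] [W.IsGloballyMinimal]
    (hX : ClassX3 W p) (hS : Additive.SubGordTwo W p) : False :=
  semistabilityIndex_ne_two_of_red_of_mem_six hJ hp W hX.1 hS.2

/-! ### §3 The primes of the row: `p ∈ {2, 3, 5, 7, 13, 37}` -/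

/-- **The primes of the reducible (G-ord, `e = 2`) row.**  If `ClassX3 W p` and `SubGordTwo W p` then `p ∈ {2, 3, 5, 7, 13, 37}`: Mazur's
Thm. 1 (`mazur_isogeny_irreducible`) puts `p` among the twelve isogeny primes and §2 removes `11, 17, 19, 43, 67, 163`.  (Census: `3, 5, 7, 13`;
at `37` only the two `X₀(37)` moduli remain, forcing `5·7 ∣ N`, beyond the census bound; `2` is excluded by the crux's own `p ≠ 2`.)  CONDITIONAL on
the two displayed published facts. [cite: Mazur1978, Thm. 1 and table p. 129] -/
theorem mem_rowPrimes_of_classX3_of_subGordTwo (hM : mazur_isogeny_irreducible)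
    (hJ : mazur_j_mem_of_not_hasIrreducibleModPGaloisRep_of_eleven_le) {p : ℕ} [Fact p.Prime] (W : WeierstrassCurve ℚ) [W.IsElliptic]
    [W.IsGloballyMinimal] (hX : ClassX3 W p) (hS : Additive.SubGordTwo W p) : p ∈ ({2, 3, 5, 7, 13, 37} : Finset ℕ) := by
  have hp : p.Prime := Fact.out
  have hmem : p ∈ mazurPrimes := by
    by_contra h
    exact hX.1 (hM W p hp h)
  simp only [mazurPrimes, Finset.mem_insert, Finset.mem_singleton] at hmem
  simp only [Finset.mem_insert, Finset.mem_singleton]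
  rcases hmem with h | h | h | h | h | h | h | h | h | h | h | h
  any_goals omega
  all_goals exact (false_of_classX3_of_subGordTwo_of_mem hJ (by omega) W hX hS).elim

/-! ### §4 The crux BY NAME from its five instances -/

/-- **Crux r3 `GordTwoBranchIMC` is the conjunction of its OWN instances at `p ∈ {3, 5, 7, 13, 37}`** (in its currency
`AdditiveIMCLowerBDPInputManinAt W p` on the cell): at every other odd prime the hypotheses `ClassX3 W p ∧ SubGordTwo W p` are contradictory (§3),
so the crux holds VACUOUSLY there.  CONDITIONAL on Mazur's two displayed published facts; nothing is closed; BSD is NOT advanced.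
[cite: Mazur1978, Thm. 1 and table p. 129] -/
theorem gordTwoBranchIMC_of_rowPrimes (hM : mazur_isogeny_irreducible) (hJ : mazur_j_mem_of_not_hasIrreducibleModPGaloisRep_of_eleven_le)
    (h : ∀ (W : WeierstrassCurve ℚ) [W.IsElliptic] [W.IsGloballyMinimal] (p : ℕ) [Fact p.Prime],
      p = 3 ∨ p = 5 ∨ p = 7 ∨ p = 13 ∨ p = 37 → W.analyticRank = 1 → ClassX3 W p → Additive.SubGordTwo W p →
        AdditiveIMCLowerBDPInputManinAt W p) :
    Summit.BirchSwinnertonDyer.BirchSwinnertonDyer.Theses.SchneiderFreeAdditiveX3.GordTwoBranchIMC := by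
  intro W _ _ p _ hr hp2 hX hS
  have hmem := mem_rowPrimes_of_classX3_of_subGordTwo hM hJ W hX hS
  simp only [Finset.mem_insert, Finset.mem_singleton] at hmem
  rcases hmem with h2 | h5
  · exact absurd h2 hp2
  · exact h W p h5 hr hX hS

end Summit.BirchSwinnertonDyer.BirchSwinnertonDyer.Theorems.SchneiderFreeAdditiveX3.KYBranchRowPrimes

end
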